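import Summits.BirchSwinnertonDyer.BirchSwinnertonDyer.Theses.UniversalToricDescent
import HarnessLib

/-!
# NODE (D-0171) — g13 · `RationalSplitIMCInclusionAtThree` (stmt-BirchSwinnertonDyer-24207)

Seat `cruxidea-stmt-BirchSwinnertonDyer-24207-1`, generation 13 (2026-08-31).  Kernel-checked composition to the crux
BY NAME (`rationalSplitIMCInclusionAtThree_of_rowsplit_hosts`), 0 sorry.  Idea card: `Ideas/untamed-cubic-host-gcd.md`;
handoff: `HANDOFF-cruxidea-24207-1-g13.md` (KEEP/KILL g13, barrier notes B-g13-1…3).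

## The decomposition (row-split × sextic host × multi-host gcd)

Write the RATWALL as `∃ k, 3ᵏ·L ∈ J` with `J = Ch_Λ(X_(∅,0))·R₀⟦T⟧` and `L = 𝓛_𝔭(f/K)²` (the crux's binders).
Let `P : WeierstrassCurve ℚ → Prop` be ANY row predicate (intended: `P W` ⇔ the inertial type of `ρ_{W,3}` is
`Dic₁₂`, i.e. the 1558 ramified-supercuspidal `SCr` rows of the O6 table) and `Excess : R₀⟦T⟧ → R₀⟦T⟧ → Prop` ANY
companion predicate (intended: `Excess L G` ⇔ `G` is the square of the `K`-line restriction of the `Σ_𝔭`-type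
BDP function of `f_M ⊗ ρ₂(M)` for an ADMISSIBLE CUBIC HOST `M` — a totally real non-Galois cubic field with
`3𝒪_M = w³`, `M_w ≅` the cubic that turns `π_{W,3}` into a (crystabelline) principal series, all `q ∣ N` split
suitably; `ρ₂(M)` = the even `S₃` Artin representation of `M`).

* **R  [`WallOn P`, WEAKER]** the wall on the `P`-rows (for the intended `P`: the `SCr` rows — left to the LEAD thin
  comb / fern; B-g13-1 shows NO base-change carrier exists there).
* **HD [`HostDivisibilityOn (¬P) Excess`, WEAKER (implied by the wall for every `Excess`); for the intended `Excess`: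
  ATTACKABLE = upstairs rational divisibility over the sextic CM field `L = KM` from the UNCONDITIONAL order-½ tempered
  CM-point carrier (torus-character level at `w`, `U_w`-refinement of slope ½) + Λ-adic Waldspurger at a crystabelline
  prime (RESEARCH leaf) + Howard/Nekovář–Fouquet KS over `L` + Artin restriction to the `K`-line]**
  `∀ G, Excess L G → ∃ k, 3ᵏ·L·G ∈ J`.
* **HG [`HostGcdOn (¬P) Excess`, UNDECIDED / IDEA-NEEDED, purely ANALYTIC — no Selmer object]** two admissible
  host-excess functions are `3`-power coprime: `∃ G₁ G₂, Excess L G₁ ∧ Excess L G₂ ∧ ∃ r s c, r·G₁ + s·G₂ = 3ᶜ`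
  (in the 2-dimensional regular local ring `R₀⟦T⟧`, "no common irreducible factor" ⇔ "the ideal `(G₁,G₂)` is
  `𝔪`-primary" ⇒ it contains a power of `3`; attack: horizontal non-vanishing mod `𝔭ⁿ` of toric periods as the host
  `M` varies, Cornut–Vatsal / Hida–Burungale technology).
* **composition** `R → HD → HG → 24207` (`rationalSplitIMCInclusionAtThree_of_rowsplit_hosts`, for every `P`,
  `Excess`); kernel = `sep_of_bezout` (ideal arithmetic) + the row split `wallOn_split`.
* **costume checks** `wallOn_of_wall`, `hostDivisibilityOn_of_wall`: 24207 ⇒ R and 24207 ⇒ HD (so neither is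
  stronger than the crux); HG is independent of the crux (for `Excess = ⊤` it is trivially true and then HD carries the
  whole content — the split is only as honest as the intended `Excess`; see the card, field "Transfer").

Barrier placement (card §Barriers): B-g10-1/B-g12-1 (trace zero — evaded: the carrier lives at the host prime `w` where
`BC(π₃)` is principal series, `U_w`-eigenvalue `≠ 0`), B-g7-3/B-g50-5/B-g11-1 (parity lock — evaded on `PS ∪ SCu`
rows by ODD degree `[M:ℚ] = 3` with ONE place over 3 of full local rank 3; NOT evaded on `SCr`: B-g13-1), B-g11-6
(C₆ rows untamable in odd degree — irrelevant: no taming is used, only principal-series-ification), B-g37-1/B-g7-1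
(value bounds give μ/λ only — not used: the carrier is Λ(ℤ₃³)⊗𝓗_{1/2}-adic), D-g50-1(ii)/g11 (componentwise cubic
descent — replaced by HG via `sep_of_bezout` over two hosts).
-/

namespace Summit.BirchSwinnertonDyer.BirchSwinnertonDyer.Cruxes.RationalSplitIMCInclusionAtThree.UntamedCubicHostGcd

open Literature.NumberTheory.EllipticCurves

/-- **R / the row-restricted wall.**  The crux telescope verbatim with one extra hypothesis `P W` after `ClassO6 W 3`. -/
def WallOn (P : WeierstrassCurve ℚ → Prop) : Prop :=
  ∀ (W : WeierstrassCurve ℚ) [W.IsElliptic] [W.IsGloballyMinimal] (N : ℕ) [NeZero N] (K : Type) [Field K] [NumberField K] (Dt : Literature.NumberTheory.EllipticCurves.ModularForms.ModularParametrizationData W N), Summit.BirchSwinnertonDyer.Rank1Residual.Additive.ClassO6 W 3 → P W → W.HasSurjectiveModNGaloisRep 3 → W.analyticRank = 1 → W.conductorNorm ℤ = N → Literature.NumberTheory.EllipticCurves.IsImaginaryQuadratic K → Literature.NumberTheory.EllipticCurves.SatisfiesHeegnerHypothesis N K → ∀ (κ : Literature.NumberTheory.EllipticCurves.ZpExtension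 K 3), κ.IsAnticyclotomic → ∀ (γ : Field.absoluteGaloisGroup K) [Fact (κ.IsTopGenerator γ)] (𝔭 : IsDedekindDomain.HeightOneSpectrum (NumberField.RingOfIntegers K)), ((3 : ℕ) : NumberField.RingOfIntegers K) ∈ 𝔭.asIdeal → 𝔭.asIdeal.ramificationIdx (NumberField.RingOfIntegers ℚ) = 1 → 𝔭.asIdeal.inertiaDeg (NumberField.RingOfIntegers ℚ) = 1 → ∀ (𝔭' : IsDedekindDomain.HeightOneSpectrum (NumberField.RingOfIntegers K)), ((3 : ℕ) : NumberField.RingOfIntegers K) ∈ 𝔭'.asIdeal → 𝔭' ≠ 𝔭 → ∀ (ι' : PadicAlgCl 3 ≃+* ℂ), Summit.BirchSwinnertonDyer.BirchSwinnertonDyer.Theorems.SchneiderFree.BranchInducesPrime 3 ι' 𝔭 → ∀ (ΩK : ℂ) (Ωp : ℂ_[3]) (L : Literature.NumberTheory.EllipticCurves.UnrSeries 3), ΩK ≠ 0 → Ωp ≠ 0 → Literature.NumberTheory.EllipticCurves.IsBDPLFunction ι' 𝔭 κ γ Dt.f ΩK Ωp L → ∃ k : ℕ, ((3 : ℕ)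 : UnrSeries 3) ^ k * L ∈ ((Summit.BirchSwinnertonDyer.Rank1Residual.X11b.AcSelmer.XAc.charIdeal (W.baseChange K) 3 κ 𝔭' ∅ γ).map (PowerSeries.map (Summit.BirchSwinnertonDyer.Rank1Residual.X11b.Halves.toUnr 3)))

/-- **HD / host divisibility on the `P`-rows.**  For every admissible companion `G` of the BDP square `L`
(`Excess L G`), `3ᵏ·L·G ∈ Ch_Λ(X_(∅,0))·R₀⟦T⟧` for some `k`.  (Intended `G`: squared `K`-line excess BDP function of
an admissible cubic host; then HD is the Artin restriction of the upstairs divisibility over `L = KM`.) -/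
def HostDivisibilityOn (P : WeierstrassCurve ℚ → Prop) (Excess : UnrSeries 3 → UnrSeries 3 → Prop) : Prop :=
  ∀ (W : WeierstrassCurve ℚ) [W.IsElliptic] [W.IsGloballyMinimal] (N : ℕ) [NeZero N] (K : Type) [Field K] [NumberField K] (Dt : Literature.NumberTheory.EllipticCurves.ModularForms.ModularParametrizationData W N), Summit.BirchSwinnertonDyer.Rank1Residual.Additive.ClassO6 W 3 → P W → W.HasSurjectiveModNGaloisRep 3 → W.analyticRank = 1 → W.conductorNorm ℤ = N → Literature.NumberTheory.EllipticCurves.IsImaginaryQuadratic K → Literature.NumberTheory.EllipticCurves.SatisfiesHeegnerHypothesis N K → ∀ (κ : Literature.NumberTheory.EllipticCurves.ZpExtension K 3), κ.IsAnticyclotomic → ∀ (γ : Field.absoluteGaloisGroup K) [Fact (κ.IsTopGenerator γ)] (𝔭 : IsDedekindDomain.HeightOneSpectrum (NumberField.RingOfIntegers K)), ((3 : ℕ) : NumberField.RingOfIntegers K) ∈ 𝔭.asIdeal → 𝔭.asIdeal.ramificationIdx (NumberField.RingOfIntegers ℚ) = 1 → 𝔭.asIdeal.inertiaDeg (NumberField.RingOfIntegers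 ℚ) = 1 → ∀ (𝔭' : IsDedekindDomain.HeightOneSpectrum (NumberField.RingOfIntegers K)), ((3 : ℕ) : NumberField.RingOfIntegers K) ∈ 𝔭'.asIdeal → 𝔭' ≠ 𝔭 → ∀ (ι' : PadicAlgCl 3 ≃+* ℂ), Summit.BirchSwinnertonDyer.BirchSwinnertonDyer.Theorems.SchneiderFree.BranchInducesPrime 3 ι' 𝔭 → ∀ (ΩK : ℂ) (Ωp : ℂ_[3]) (L : Literature.NumberTheory.EllipticCurves.UnrSeries 3), ΩK ≠ 0 → Ωp ≠ 0 → Literature.NumberTheory.EllipticCurves.IsBDPLFunction ι' 𝔭 κ γ Dt.f ΩK Ωp L → ∀ G : UnrSeries 3, Excess L G → ∃ k : ℕ, ((3 : ℕ) : UnrSeries 3) ^ k * L * G ∈ ((Summit.BirchSwinnertonDyer.Rank1Residual.X11b.AcSelmer.XAc.charIdeal (W.baseChange K) 3 κ 𝔭' ∅ γ).map (PowerSeries.map (Summit.BirchSwinnertonDyer.Rank1Residual.X11b.Halves.toUnr 3)))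

/-- **HG / multi-host gcd (purely analytic).**  On the `P`-rows there are two admissible companions `G₁, G₂` of `L`
with a `3`-power Bézout relation `r·G₁ + s·G₂ = 3ᶜ` (⇔ `G₁, G₂` have no common irreducible factor in `R₀⟦T⟧`). -/
def HostGcdOn (P : WeierstrassCurve ℚ → Prop) (Excess : UnrSeries 3 → UnrSeries 3 → Prop) : Prop :=
  ∀ (W : WeierstrassCurve ℚ) [W.IsElliptic] [W.IsGloballyMinimal] (N : ℕ) [NeZero N] (K : Type) [Field K] [NumberField K] (Dt : Literature.NumberTheory.EllipticCurves.ModularForms.ModularParametrizationData W N), Summit.BirchSwinnertonDyer.Rank1Residual.Additive.ClassO6 W 3 → P W → W.HasSurjectiveModNGaloisRep 3 → W.analyticRank = 1 → W.conductorNorm ℤ = N → Literature.NumberTheory.EllipticCurves.IsImaginaryQuadratic K → Literature.NumberTheory.EllipticCurves.SatisfiesHeegnerHypothesis N K → ∀ (κ : Literature.NumberTheory.EllipticCurves.ZpExtension K 3), κ.IsAnticyclotomic → ∀ (γ : Field.absoluteGaloisGroup K) [Fact (κ.IsTopGenerator γ)] (𝔭 : IsDedekindDomain.HeightOneSpectrum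 (NumberField.RingOfIntegers K)), ((3 : ℕ) : NumberField.RingOfIntegers K) ∈ 𝔭.asIdeal → 𝔭.asIdeal.ramificationIdx (NumberField.RingOfIntegers ℚ) = 1 → 𝔭.asIdeal.inertiaDeg (NumberField.RingOfIntegers ℚ) = 1 → ∀ (𝔭' : IsDedekindDomain.HeightOneSpectrum (NumberField.RingOfIntegers K)), ((3 : ℕ) : NumberField.RingOfIntegers K) ∈ 𝔭'.asIdeal → 𝔭' ≠ 𝔭 → ∀ (ι' : PadicAlgCl 3 ≃+* ℂ), Summit.BirchSwinnertonDyer.BirchSwinnertonDyer.Theorems.SchneiderFree.BranchInducesPrime 3 ι' 𝔭 → ∀ (ΩK : ℂ) (Ωp : ℂ_[3]) (L : Literature.NumberTheory.EllipticCurves.UnrSeries 3), ΩK ≠ 0 → Ωp ≠ 0 → Literature.NumberTheory.EllipticCurves.IsBDPLFunction ι' 𝔭 κ γ Dt.f ΩK Ωp L → ∃ G₁ G₂ : UnrSeries 3, Excess L G₁ ∧ Excess L G₂ ∧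
    ∃ (r s : UnrSeries 3) (c : ℕ), r * G₁ + s * G₂ = ((3 : ℕ) : UnrSeries 3) ^ c

/-! ## Kernel: separation by a Bézout relation (any commutative ring) -/

/-- **`sep_of_bezout`.**  If `a·G₁ ∈ J`, `a·G₂ ∈ J` and `r·G₁ + s·G₂ = t` then `a·t ∈ J`. -/
theorem sep_of_bezout {A : Type*} [CommRing A] (J : Ideal A) {a G₁ G₂ r s t : A}
    (h₁ : a * G₁ ∈ J) (h₂ : a * G₂ ∈ J) (hb : r * G₁ + s * G₂ = t) : a * t ∈ J := by
  have key : a * t = r * (a * G₁) + s * (a * G₂) := by rw [← hb]; ring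
  rw [key]
  exact J.add_mem (J.mul_mem_left r h₁) (J.mul_mem_left s h₂)

/-- Uniformising the slack: `3^{k₁}·L·G ∈ J ⇒ 3^{k₁+k₂}·L·G ∈ J`. -/
theorem pow_mul_mem_of_le {A : Type*} [CommRing A] (J : Ideal A) {x b : A} {k₁ k₂ : ℕ}
    (h : b ^ k₁ * x ∈ J) : b ^ (k₁ + k₂) * x ∈ J := by
  have key : b ^ (k₁ + k₂) * x = b ^ k₂ * (b ^ k₁ * x) := by rw [pow_add]; ring
  rw [key]
  exact J.mul_mem_left _ h

/-! ## The row split -/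

/-- **Row-split door.**  The wall on the `P`-rows and on the `¬P`-rows give the crux. -/
theorem wallOn_split (P : WeierstrassCurve ℚ → Prop)
    (hP : WallOn P) (hnP : WallOn (fun W => ¬ P W)) :
    Summit.BirchSwinnertonDyer.BirchSwinnertonDyer.Theses.UniversalToricDescent.RationalSplitIMCInclusionAtThree := by
  intro W _ _ N _ K _ _ Dt hO6 hsurj hr1 hN hK hH κ hκ γ _ 𝔭 h𝔭 he hf 𝔭' h𝔭' hne ι' hι ΩK Ωp L hΩK hΩp hL
  by_cases hW : P W
  · exact hP W N K Dt hO6 hW hsurj hr1 hN hK hH κ hκ γ 𝔭 h𝔭 he hf 𝔭' h𝔭' hne ι' hι ΩK Ωp L hΩK hΩp hL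
  · exact hnP W N K Dt hO6 hW hsurj hr1 hN hK hH κ hκ γ 𝔭 h𝔭 he hf 𝔭' h𝔭' hne ι' hι ΩK Ωp L hΩK hΩp hL

/-- **HD ∧ HG ⇒ the wall on the `P`-rows** (for every `P`, `Excess`). -/
theorem wallOn_of_hosts (P : WeierstrassCurve ℚ → Prop) (Excess : UnrSeries 3 → UnrSeries 3 → Prop)
    (hD : HostDivisibilityOn P Excess) (hG : HostGcdOn P Excess) : WallOn P := by
  intro W _ _ N _ K _ _ Dt hO6 hW hsurj hr1 hN hK hH κ hκ γ _ 𝔭 h𝔭 he hf 𝔭' h𝔭' hne ι' hι ΩK Ωp L hΩK hΩp hL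
  obtain ⟨G₁, G₂, hE₁, hE₂, r, s, c, hb⟩ :=
    hG W N K Dt hO6 hW hsurj hr1 hN hK hH κ hκ γ 𝔭 h𝔭 he hf 𝔭' h𝔭' hne ι' hι ΩK Ωp L hΩK hΩp hL
  obtain ⟨k₁, hk₁⟩ :=
    hD W N K Dt hO6 hW hsurj hr1 hN hK hH κ hκ γ 𝔭 h𝔭 he hf 𝔭' h𝔭' hne ι' hι ΩK Ωp L hΩK hΩp hL G₁ hE₁
  obtain ⟨k₂, hk₂⟩ :=
    hD W N K Dt hO6 hW hsurj hr1 hN hK hH κ hκ γ 𝔭 h𝔭 he hf 𝔭' h𝔭' hne ι' hι ΩK Ωp L hΩK hΩp hL G₂ hE₂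
  set J := ((Summit.BirchSwinnertonDyer.Rank1Residual.X11b.AcSelmer.XAc.charIdeal (W.baseChange K) 3 κ 𝔭' ∅ γ).map (PowerSeries.map (Summit.BirchSwinnertonDyer.Rank1Residual.X11b.Halves.toUnr 3))) with hJ
  set b : UnrSeries 3 := ((3 : ℕ) : UnrSeries 3) with hb3
  have h₁ : b ^ (k₁ + k₂) * L * G₁ ∈ J := by
    have := pow_mul_mem_of_le J (x := L * G₁) (b := b) (k₁ := k₁) (k₂ := k₂) (by simpa [mul_assoc] using hk₁)
    simpa [mul_assoc] using this
  have h₂ : b ^ (k₁ + k₂) * L * G₂ ∈ J := by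
    have := pow_mul_mem_of_le J (x := L * G₂) (b := b) (k₁ := k₂) (k₂ := k₁) (by simpa [mul_assoc] using hk₂)
    simpa [mul_assoc, Nat.add_comm] using this
  refine ⟨k₁ + k₂ + c, ?_⟩
  have key : b ^ (k₁ + k₂ + c) * L = b ^ (k₁ + k₂) * L * b ^ c := by rw [pow_add]; ring
  rw [key]
  exact sep_of_bezout J h₁ h₂ hb

/-- **COMPOSITION TO THE CRUX BY NAME.**  `R (wall on the P-rows) → HD (¬P) → HG (¬P) → 24207`. -/
theorem rationalSplitIMCInclusionAtThree_of_rowsplit_hosts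
    (P : WeierstrassCurve ℚ → Prop) (Excess : UnrSeries 3 → UnrSeries 3 → Prop)
    (hR : WallOn P) (hD : HostDivisibilityOn (fun W => ¬ P W) Excess) (hG : HostGcdOn (fun W => ¬ P W) Excess) :
    Summit.BirchSwinnertonDyer.BirchSwinnertonDyer.Theses.UniversalToricDescent.RationalSplitIMCInclusionAtThree :=
  wallOn_split P hR (wallOn_of_hosts _ Excess hD hG)

/-! ## Costume checks: the crux implies R and HD (neither piece is stronger than 24207) -/

theorem wallOn_of_wall (P : WeierstrassCurve ℚ → Prop)
    (h : Summit.BirchSwinnertonDyer.BirchSwinnertonDyer.Theses.UniversalToricDescent.RationalSplitIMCInclusionAtThree) :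
    WallOn P := by
  intro W _ _ N _ K _ _ Dt hO6 _hW hsurj hr1 hN hK hH κ hκ γ _ 𝔭 h𝔭 he hf 𝔭' h𝔭' hne ι' hι ΩK Ωp L hΩK hΩp hL
  exact h W N K Dt hO6 hsurj hr1 hN hK hH κ hκ γ 𝔭 h𝔭 he hf 𝔭' h𝔭' hne ι' hι ΩK Ωp L hΩK hΩp hL

theorem hostDivisibilityOn_of_wall (P : WeierstrassCurve ℚ → Prop) (Excess : UnrSeries 3 → UnrSeries 3 → Prop)
    (h : Summit.BirchSwinnertonDyer.BirchSwinnertonDyer.Theses.UniversalToricDescent.RationalSplitIMCInclusionAtThree) :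
    HostDivisibilityOn P Excess := by
  intro W _ _ N _ K _ _ Dt hO6 _hW hsurj hr1 hN hK hH κ hκ γ _ 𝔭 h𝔭 he hf 𝔭' h𝔭' hne ι' hι ΩK Ωp L hΩK hΩp hL G _hG
  obtain ⟨k, hk⟩ := h W N K Dt hO6 hsurj hr1 hN hK hH κ hκ γ 𝔭 h𝔭 he hf 𝔭' h𝔭' hne ι' hι ΩK Ωp L hΩK hΩp hL
  exact ⟨k, Ideal.mul_mem_right G _ hk⟩

/-- With the vacuous companion predicate `⊤`, HG holds trivially (`G₁ = G₂ = 1`, `1·1 + 0·1 = 3⁰`): the honest content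
of the split lives in the INTENDED `Excess` (card, field Transfer) — recorded here so no one mistakes HG(⊤) for progress. -/
theorem hostGcdOn_top (P : WeierstrassCurve ℚ → Prop) : HostGcdOn P (fun _ _ => True) := by
  intro W _ _ N _ K _ _ Dt hO6 _hW hsurj hr1 hN hK hH κ hκ γ _ 𝔭 h𝔭 he hf 𝔭' h𝔭' hne ι' hι ΩK Ωp L hΩK hΩp hL
  exact ⟨1, 1, trivial, trivial, 1, 0, 0, by simp⟩

/-- Kernel anchor of the parity bookkeeping behind B-g13-1 / the host choice: an odd-degree host has sign
`(−1)^{[M:ℚ]} = −1` (indefinite), an even one `+1` (definite); and `6 ∤ n` for odd `n` (the index-6 kernel of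
`ξ′/ξ′^σ` on the `SCr` rows cannot contain the norm group of an odd-degree extension). -/
theorem parity_anchor : ((-1 : ℤ) ^ 3 = -1 ∧ (-1 : ℤ) ^ 2 = 1) ∧ ∀ n : ℕ, n % 2 = 1 → ¬ (6 ∣ n) := by
  refine ⟨by norm_num, fun n hn h6 => ?_⟩
  obtain ⟨m, rfl⟩ := h6
  omega

end Summit.BirchSwinnertonDyer.BirchSwinnertonDyer.Cruxes.RationalSplitIMCInclusionAtThree.UntamedCubicHostGcd
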